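import Literature.MathematicalPhysics.QuantumLattice.CentreSymmetryDobrushin
import Literature.MathematicalPhysics.QuantumFieldTheory.YangMillsOS
import HarnessLib

/-!
# Crux `DeconfinedIsMassless` (stmt-QuantumFields-19521), stub A at STRONG COUPLING:
# slab centre symmetry of `SU(N)₄` is unbroken at every width whenever `108 · r.N · |β| < 1`

Helper file (`--supports stmt-QuantumFields-19521`, closes nothing) of the PORT lane `ym-lit-19521-confcrit` (g1) for the
crux `DeconfinedIsMassless` of the REFUTATION route `route-QuantumFields-WeakCouplingMasslessPhase`. The birth skeleton
`Cruxes/DeconfinedIsMassless/Lines/birth.lean` (sha `ebd9e11d7074`) cuts the crux at Chatterjee's slab centre symmetry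
(CMP 385 (2021), Def. 2.1): stub A `stub_centreUnbroken_of_torusClustering` (open, XL: volume-uniform torus clustering of
ONE pair of species ⇒ the inlined «slab centre symmetry unbroken at some width `W` under every boundary condition») and
stub B `stub_not_perimeter_of_centreUnbroken` (LANDED, p530803).

What is proved here (sorry-free, no new definition, no named fact):

* `inlined_of_slabCentreUnbroken` — the converse bookkeeping of `centreUnbroken_of_inlined` (stub-B file): the tree's
  `SlabCentreUnbroken ρ β W δ` for all `δ` (Chatterjee Def. 2.1 at width `W`, `CentreSymmetry.lean`) gives the planner's
  inlined clause at width `W` verbatim (a measure satisfying the inlined boundary/DLR clauses is a member of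
  `slabGibbsMeasures ρ β W δ`; the planner's transform is `centreTransform z`).
* ★ `slabCentre_inlined_of_strongCoupling` — **stub A's CONCLUSION at strong coupling, for EVERY width**: for every `N`,
  every lattice representation `r` of `SU(N)` and every `β` with `108 · r.N · |β| < 1`, the inlined slab-centre clause holds
  at every `W ≥ 1` — by the Literature theorem `slabCentreUnbroken_of_unitary` (`CentreSymmetryDobrushin.lean`, this lane:
  Dobrushin's condition in the total-variation form for the Wilson specification, row sum `12 (d−1)² N |β| = 108 r.N |β|`
  at `d = 4`, ⇒ the slab theory with boundary condition `δ` has at most one Gibbs measure ⇒ it is centre invariant).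
* ★ `stub_centreUnbroken_of_torusClustering_strongCoupling` — the RUNG in the registered shape: stub A with the single
  extra hypothesis `108 · r.N · β < 1` (the clustering hypothesis is then not needed; species `A = B = r.curvature`).
  This is the BC5-style proved instance of stub A: its conclusion is TRUE throughout the strong-coupling window, for every
  `N ≥ 2` and every faithful `r`, independently of the open torus-clustering ⇒ arbitrary-boundary-condition bridge.
* The composition with the landed stub B (no perimeter law in any torus limit state for `0 < β < 1/(108 r.N)`) is the
  companion file `…DeconfinedIsMasslessStrongCouplingNoPerimeter.lean`; THIS file is route-independent (imports no
  `Theses` module: only Literature), so that positive routes can import the rung without entering the route's cone.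

HONEST FRAMING. Strong-coupling statements only; stub A (all `β > 0`) remains open — its content is the large-`β` bridge
«torus clustering of one pair ⇒ unbroken slab centre symmetry», for which nothing is claimed here.

Sources: S. Chatterjee, CMP 385 (2021) 1007–1039, arXiv:2006.16229, Def. 2.1, Thm. 2.2, §2.4 p. 7 («for essentially any
lattice gauge theory when β is small enough, using the methods of [Dobrushin–Shlosman]»); H.-O. Georgii, *Gibbs Measures and
Phase Transitions* (2011), Thm. 8.20; B. Simon, CMP 68 (1979) 183.
-/

set_option autoImplicit false

noncomputable section

namespace Summit.QuantumFields.YangMills.Theorems.DeconfinedIsMassless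

open MeasureTheory Filter Topology
open Literature.Probability.LatticeModels
open Literature.MathematicalPhysics
open Literature.MathematicalPhysics.QuantumLattice

variable {N : ℕ}

/-! ### The tree's `SlabCentreUnbroken` gives the planner's inlined clause -/

/-- **Converse bookkeeping of `centreUnbroken_of_inlined`.** If the slab theory of height `W` has unbroken centre symmetry
under every boundary condition in the tree's sense (`SlabCentreUnbroken ρ β W δ` for all `δ`, Chatterjee 2021 Def. 2.1 at
width `W`), then the planner's inlined clause holds at width `W`: every probability measure equal to `δ` a.e. off the
interior edges (`x₀ < W` ⟺ `x₀ + 1 ≤ W` on `ℤ`) and DLR for the interior Wilson kernels is a member of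
`slabGibbsMeasures ρ β W δ` (`slabSpecification ρ β W Λ = ymSpecification ρ β (Λ ∩ interior)`), and the planner's transform
is `centreTransform z`. [cite: Chatterjee2021, Def. 2.1] -/
theorem inlined_of_slabCentreUnbroken {M : ℕ} (ρ : Matrix.specialUnitaryGroup (Fin N) ℂ →* Matrix (Fin M) (Fin M) ℂ)
    (β : ℝ) {W : ℕ} (h : ∀ δ : LGConfig 4 (Matrix.specialUnitaryGroup (Fin N) ℂ), SlabCentreUnbroken ρ β W δ) :
    ∀ (δ : QuantumLattice.LGConfig 4 (Matrix.specialUnitaryGroup (Fin N) ℂ)) (μ : Measure (QuantumLattice.LGConfig 4 (Matrix.specialUnitaryGroup (Fin N) ℂ))), IsProbabilityMeasure μ → (∀ᵐ U ∂μ, ∀ e : QuantumLattice.ZdEdge 4, ¬ ((e.2 = 0 ∧ 0 ≤ e.1 0 ∧ e.1 0 < (W : ℤ)) ∨ (e.2 ≠ 0 ∧ 0 < e.1 0 ∧ e.1 0 < (W : ℤ))) → U e = δ e) → (∀ Λ : Finset (QuantumLattice.ZdEdge 4), (∀ e ∈ Λ, (e.2 = 0 ∧ 0 ≤ e.1 0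 ∧ e.1 0 < (W : ℤ)) ∨ (e.2 ≠ 0 ∧ 0 < e.1 0 ∧ e.1 0 < (W : ℤ))) → ∀ E : Set (QuantumLattice.LGConfig 4 (Matrix.specialUnitaryGroup (Fin N) ℂ)), MeasurableSet E → ∫⁻ η, QuantumLattice.ymSpecification (d := 4) ρ β Λ η E ∂μ = μ E) → ∀ z : Matrix.specialUnitaryGroup (Fin N) ℂ, z ∈ Subgroup.center (Matrix.specialUnitaryGroup (Fin N) ℂ) → μ.map (fun (U : QuantumLattice.LGConfig 4 (Matrix.specialUnitaryGroup (Fin N) ℂ)) (e : QuantumLattice.ZdEdge 4) => if e.2 = 0 ∧ e.1 0 = 0 then z * U e else U e) = μ := by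
  intro δ μ hprob hbc hdlr z hz
  -- the planner's interior predicate is `IsSlabInteriorEdge W` (`x₀ < W ↔ x₀ + 1 ≤ W` on `ℤ`)
  have hiff : ∀ e : ZdEdge 4, ((e.2 = 0 ∧ 0 ≤ e.1 0 ∧ e.1 0 < (W : ℤ)) ∨ (e.2 ≠ 0 ∧ 0 < e.1 0 ∧ e.1 0 < (W : ℤ))) ↔
      IsSlabInteriorEdge W e := fun e => by
    simp only [IsSlabInteriorEdge, Int.lt_iff_add_one_le]
  -- `μ` is a slab Gibbs measure with boundary condition `δ`
  have hmem : μ ∈ slabGibbsMeasures ρ β W δ := by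
    refine ⟨⟨hprob, fun Λ E hE => ?_⟩, ?_⟩
    · -- DLR for the slab kernel of `Λ` = Wilson kernel of `Λ ∩ interior`
      have hΛ : ∀ e ∈ Λ.filter (IsSlabInteriorEdge (d := 4) W),
          (e.2 = 0 ∧ 0 ≤ e.1 0 ∧ e.1 0 < (W : ℤ)) ∨ (e.2 ≠ 0 ∧ 0 < e.1 0 ∧ e.1 0 < (W : ℤ)) := fun e he =>
        (hiff e).2 (Finset.mem_filter.1 he).2
      exact hdlr _ hΛ E hE
    · filter_upwards [hbc] with U hU e he
      exact hU e (fun h' => he ((hiff e).1 h'))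
  exact h δ z hz μ hmem

/-! ### Stub A's conclusion at strong coupling, every width -/

/-- ★ **Slab centre symmetry of `SU(N)₄` is unbroken at EVERY width throughout the strong-coupling window
`108 · r.N · |β| < 1`** (every `N`, every continuous unitary lattice representation `r`; the inlined clause of stub A):
the Wilson specification `ymSpecification r.ρ β` satisfies Dobrushin's condition in the total-variation form with row sums
`12 · (4−1)² · r.N · |β|` (`|Re tr r.ρ(U_p)| ≤ r.N`), so each slab theory with boundary condition `δ` has at most one Gibbs
measure and is therefore invariant under the centre transforms (Literature `slabCentreUnbroken_of_unitary`,
`CentreSymmetryDobrushin.lean`), and `inlined_of_slabCentreUnbroken` renders it in the planner's clause.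
[cite: Chatterjee2021, Def. 2.1 and §2.4 (p. 7)] -/
theorem slabCentre_inlined_of_strongCoupling (r : QuantumFieldTheory.LatticeRep (Matrix.specialUnitaryGroup (Fin N) ℂ))
    (β : ℝ) (hβ : 108 * (r.N : ℝ) * |β| < 1) (W : ℕ) (hW : 1 ≤ W) :
    ∀ (δ : QuantumLattice.LGConfig 4 (Matrix.specialUnitaryGroup (Fin N) ℂ)) (μ : Measure (QuantumLattice.LGConfig 4 (Matrix.specialUnitaryGroup (Fin N) ℂ))), IsProbabilityMeasure μ → (∀ᵐ U ∂μ, ∀ e : QuantumLattice.ZdEdge 4, ¬ ((e.2 = 0 ∧ 0 ≤ e.1 0 ∧ e.1 0 < (W : ℤ)) ∨ (e.2 ≠ 0 ∧ 0 < e.1 0 ∧ e.1 0 < (W : ℤ))) → U e = δ e) → (∀ Λ : Finset (QuantumLattice.ZdEdge 4), (∀ e ∈ Λ, (e.2 = 0 ∧ 0 ≤ e.1 0 ∧ e.1 0 < (W : ℤ)) ∨ (e.2 ≠ 0 ∧ 0 < e.1 0 ∧ e.1 0 < (W : ℤ))) → ∀ E : Set (QuantumLattice.LGConfig 4 (Matrix.specialUnitaryGroup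 (Fin N) ℂ)), MeasurableSet E → ∫⁻ η, QuantumLattice.ymSpecification (d := 4) r.ρ β Λ η E ∂μ = μ E) → ∀ z : Matrix.specialUnitaryGroup (Fin N) ℂ, z ∈ Subgroup.center (Matrix.specialUnitaryGroup (Fin N) ℂ) → μ.map (fun (U : QuantumLattice.LGConfig 4 (Matrix.specialUnitaryGroup (Fin N) ℂ)) (e : QuantumLattice.ZdEdge 4) => if e.2 = 0 ∧ e.1 0 = 0 then z * U e else U e) = μ := by
  refine inlined_of_slabCentreUnbroken r.ρ β fun δ => ?_
  have hβ' : 12 * ((4 - 1 : ℕ) : ℝ) ^ 2 * (r.N : ℝ) * |β| < 1 := by norm_num; linarith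
  exact slabCentreUnbroken_of_unitary (d := 4) r.ρ r.continuous r.mem_unitary hβ' hW δ

/-- The tree form: **Chatterjee's Definition 2.1 holds for the `r`-Wilson theory of `SU(N)₄` whenever
`108 · r.N · |β| < 1`** (`CentreUnbroken 4 r.ρ β`). [cite: Chatterjee2021, Def. 2.1 and §2.4 (p. 7)] -/
theorem centreUnbroken_of_strongCoupling (r : QuantumFieldTheory.LatticeRep (Matrix.specialUnitaryGroup (Fin N) ℂ))
    (β : ℝ) (hβ : 108 * (r.N : ℝ) * |β| < 1) : CentreUnbroken 4 r.ρ β := by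
  have hβ' : 12 * ((4 - 1 : ℕ) : ℝ) ^ 2 * (r.N : ℝ) * |β| < 1 := by norm_num; linarith
  exact centreUnbroken_of_unitary (d := 4) r.ρ r.continuous r.mem_unitary hβ'

/-- ★ **RUNG of stub A (registered shape + one strong-coupling hypothesis).** For every `N ≥ 2` and every lattice
representation `r` of `SU(N)` there are species `A, B` (here both `r.curvature`; any pair works) such that for every
`β > 0` with `108 · r.N · β < 1`: [the crux's uniform torus-clustering clause — not used] ⇒ there is a width `W ≥ 1`
(here `W = 1`; every width works, `slabCentre_inlined_of_strongCoupling`) at which the inlined slab centre symmetry is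
unbroken under every boundary condition. Stub A asserts this for ALL `β > 0`; the present theorem is its proved
strong-coupling instance. [cite: Chatterjee2021, Def. 2.1 and §2.4 (p. 7)] -/
theorem stub_centreUnbroken_of_torusClustering_strongCoupling :
    ∀ (N : ℕ), 2 ≤ N → ∀ r : QuantumFieldTheory.LatticeRep (Matrix.specialUnitaryGroup (Fin N) ℂ), ∃ A B : QuantumFieldTheory.YMSpecies (Matrix.specialUnitaryGroup (Fin N) ℂ), ∀ β : ℝ, 0 < β → 108 * (r.N : ℝ) * β < 1 → (∃ (C m : ℝ) (S₀ : ℕ), 0 < m ∧ ∀ S : ℕ, S₀ ≤ S → ∀ n : ℕ, n ≤ S → |QuantumFieldTheory.latticeConnectedCorr r.ρ β (2 * S + 1) A.F B.F n| ≤ C * Real.exp (-(m * n))) → ∃ W : ℕ, 1 ≤ W ∧ ∀ (δ : QuantumLattice.LGConfig 4 (Matrix.specialUnitaryGroup (Fin N) ℂ)) (μ : Measure (QuantumLattice.LGConfig 4 (Matrix.specialUnitaryGroup (Fin N) ℂ))), IsProbabilityMeasure μ → (∀ᵐ U ∂μ, ∀ e : QuantumLattice.ZdEdge 4, ¬ ((e.2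 = 0 ∧ 0 ≤ e.1 0 ∧ e.1 0 < (W : ℤ)) ∨ (e.2 ≠ 0 ∧ 0 < e.1 0 ∧ e.1 0 < (W : ℤ))) → U e = δ e) → (∀ Λ : Finset (QuantumLattice.ZdEdge 4), (∀ e ∈ Λ, (e.2 = 0 ∧ 0 ≤ e.1 0 ∧ e.1 0 < (W : ℤ)) ∨ (e.2 ≠ 0 ∧ 0 < e.1 0 ∧ e.1 0 < (W : ℤ))) → ∀ E : Set (QuantumLattice.LGConfig 4 (Matrix.specialUnitaryGroup (Fin N) ℂ)), MeasurableSet E → ∫⁻ η, QuantumLattice.ymSpecification (d := 4) r.ρ β Λ η E ∂μ = μ E) → ∀ z : Matrix.specialUnitaryGroup (Fin N) ℂ, z ∈ Subgroup.center (Matrix.specialUnitaryGroup (Fin N) ℂ) → μ.map (fun (U : QuantumLattice.LGConfig 4 (Matrix.specialUnitaryGroup (Fin N) ℂ)) (e : QuantumLattice.ZdEdge 4) => if e.2 = 0 ∧ e.1 0 = 0 then z * U e else U e) = μ := by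
  intro N _hN r
  refine ⟨r.curvature, r.curvature, fun β hβ hsmall _hclust => ⟨1, le_rfl, ?_⟩⟩
  have hβ' : 108 * (r.N : ℝ) * |β| < 1 := by rwa [abs_of_pos hβ]
  exact slabCentre_inlined_of_strongCoupling r β hβ' 1 le_rfl

end Summit.QuantumFields.YangMills.Theorems.DeconfinedIsMassless

end
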